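import Summits.ResolutionOfSingularities.ResolutionOfSingularities.Theorems.EquisingularLiftEquisingularLiftNatMultisectionInputs
import Summits.ResolutionOfSingularities.ResolutionOfSingularities.Theorems.EquisingularLiftEquisingularLiftNatMultisectionRational
import Summits.ResolutionOfSingularities.ResolutionOfSingularities.Theorems.EquisingularLiftEquisingularLiftNatEmbDimDrop
import Summits.ResolutionOfSingularities.ResolutionOfSingularities.Theorems.EquisingularLiftEquisingularLiftNatChainIntegral
import Summits.ResolutionOfSingularities.ResolutionOfSingularities.Theorems.EquisingularLiftEquisingularLiftResolveOnePointDimOne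
import Literature.AlgebraicGeometry.Resolution.SNCStrataSmooth
import Literature.AlgebraicGeometry.Resolution.ComponentGluing
import HarnessLib

/-!
# [OURS · L1 W4.5(b) · EL♮] The ADAPTER `hMS` := T-MULTISEC ⇒ T-TAIL: the (MS) device of `horizChainE1_of_pointResolvable`
# from ramified multisections (crux `EquisingularLiftNat` = stmt-ResolutionOfSingularities-20038)

HONEST FRAMING. OURS (cell res-hironaka, crux chain w45b, slot W4.5(b)); NOT a statement of any manuscript; AI-written,
weaker than expert review. Helper `--supports stmt-ResolutionOfSingularities-20038 --as helper` (requested by res-D-pv-013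
2026-08-27T07:37:46Z). This file discharges, for a concrete admissibility predicate `Adm`, the hypothesis `hMS` of T-TAIL
(`horizChainE1_of_pointResolvable` p508794 / `horizChainE1_of_pointResolvableInv` p510285, binder copied verbatim) from
T-MULTISEC (`exists_multisection` p510326) and the input lemmas L-INJ (`injective_stalkHom_of_isIntegral` p511070), L-RAT
(`residue_comp_stalkHom_surjective` p512254), res-D-pv-013's chain integrality (`chain_isIntegral_and_exists_over_genericPoint`
p512051) and res-type-097's ring brick B2 (`…NatEmbDimDrop` p512120).

* `asIdeal_apply_genericPoint_eq_bot` — a flat `q : P → Spec O` (`O` a domain, `P` integral and non-empty) sends the generic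
  point of `P` to the generic point.
* `exists_centre_of_stage` — per-stage core: an INTEGRAL proper `r : X' → Spec O` with a point off the special fibre, `T ⊆ r⁻¹{s₀}`
  closed, `z ∈ V(T)_red` closed in `X'` with `𝒪_{X',ι z}` regular and `(I_T)_{ι z} ⊄ 𝔪²` ⟹ the (MS) conclusion at `z`.
* `spanFinrank_maximalIdeal_stalk_le_of_iso` — iso-invariance (`hAdm`) of the EMBEDDING-DIMENSION predicate
  `Adm Γ x :⟺ μ(𝔪_{Γ,x}) ≤ n` (minimal number of generators; no Noetherian proviso, so it holds for ALL schemes as T-TAIL asks).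
* `hMS_of_multisection` — **the adapter** for `Adm Γ x :⟺ μ(𝔪_{Γ,x}) ≤ n`: given `P` integral, `q` smooth, `Y ⊆ q⁻¹{s₀}` closed
  irreducible, `Ch ⇒ Chain`, `O` a COMPLETE DVR with ALGEBRAICALLY CLOSED residue field, and the per-stage dimension input
  `hdim` «`dim 𝒪_{X',x} = n + 1` at closed special points of `Ch`-stages» (T-DIM, res-L1-w45b-stub-2 g4, taken as a hypothesis),
  the (MS) binder of T-TAIL holds verbatim.
* `hMS_of_multisection_finrank` — the same for res-D-pv-013's spelling `Adm Γ x :⟺ dim_κ 𝔪_{Γ,x}/𝔪² ≤ n` (equal to `μ` on the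
  Noetherian stalks that occur; its iso-invariance over arbitrary schemes is NOT supplied here — use the `μ` form with T-TAIL).

References: Matsumura, *Commutative Ring Theory*, Thm. 8.4, 14.2 [Matsumura1987] — through the cited tree files.
-/

set_option linter.dupNamespace false -- mandated namespace `Summit.<Summit>.<Problem>` of this single-conjunct summit

open CategoryTheory CategoryTheory.Limits AlgebraicGeometry TopologicalSpace Topology IsLocalRing
open Literature.AlgebraicGeometry.Resolution
open AlgebraicGeometry.Scheme.IdealSheafData
open Summit.ResolutionOfSingularities.ResolutionOfSingularities.Theses.EquisingularLift.Split
open Summit.ResolutionOfSingularities.ResolutionOfSingularities.Cruxes.EquisingularLift.StrataSplit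

namespace Summit.ResolutionOfSingularities.ResolutionOfSingularities.Cruxes.EquisingularLiftNat.Sections

/-! ## Dominance of a flat structure map -/

/-- For `P` integral (and non-empty: a point `y` is given) and `q : P → Spec O` FLAT over a domain, `q` sends the generic
point of `P` to the generic point of `Spec O` (flat morphisms are generalising). [folklore] -/
theorem asIdeal_apply_genericPoint_eq_bot {O : Type} [CommRing O] [IsDomain O]
    {P : Scheme.{0}} [IsIntegral P] (q : P ⟶ Spec (.of O)) [Flat q] (y : P) :
    (q (genericPoint P)).asIdeal = ⊥ := by
  have hgen := Flat.generalizingMap q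
  let η₀ : Spec (.of O) := ⟨⊥, Ideal.isPrime_bot⟩
  have hη : η₀ ⤳ q y := (PrimeSpectrum.le_iff_specializes η₀ _).mp bot_le
  obtain ⟨x, -, hx⟩ := hgen hη
  have hsp : q (genericPoint P) ⤳ q x := (genericPoint_specializes x).map q.continuous
  have hle : (q (genericPoint P)).asIdeal ≤ (q x).asIdeal :=
    (PrimeSpectrum.asIdeal_le_asIdeal _ _).mpr ((PrimeSpectrum.le_iff_specializes _ _).mpr hsp)
  rw [hx] at hle
  exact le_bot_iff.mp hle

/-- In a discrete valuation ring a point of `Spec O` other than the closed point is the generic point. [folklore] -/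
theorem asIdeal_eq_bot_of_ne_closedPoint {O : Type} [CommRing O] [IsDomain O] [IsDiscreteValuationRing O]
    {s : Spec (.of O)} (hs : s ≠ closedPoint O) : s.asIdeal = ⊥ := by
  by_contra h0
  have hmax : s.asIdeal.IsMaximal := Ring.DimensionLEOne.maximalOfPrime h0 s.isPrime
  exact hs (PrimeSpectrum.ext (IsLocalRing.eq_maximalIdeal hmax))

/-! ## The per-stage core -/

/-- **(MS) at one stage, from T-MULTISEC.** `O` a complete DVR with algebraically closed residue field; `X'` INTEGRAL,
`r : X' → Spec O` proper with a point `x` off the special fibre; `T ⊆ r⁻¹{s₀}` closed; `z ∈ V(T)_red` with `ι z` closed in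
`X'`, `𝒪_{X',ι z}` regular and `(I_T)_{ι z} ⊄ 𝔪²`. Then there is an ideal sheaf `C` with `V(C)` regular, `V(C) → Spec O` flat,
`supp C ∩ r⁻¹{s₀} = {ι z}` and `C · 𝒪_{V(T)} = 𝓘_{{z}}` (horizontality by L-INJ, `k`-rationality by L-RAT, then
`exists_multisection`). [folklore packaging; cite: Matsumura1987, Thm. 8.4] -/
theorem exists_centre_of_stage {O : Type} [CommRing O] [IsDomain O] [IsDiscreteValuationRing O]
    [IsAdicComplete (maximalIdeal O) O] [IsAlgClosed (ResidueField O)]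
    {X' : Scheme.{0}} [IsIntegral X'] (r : X' ⟶ Spec (.of O)) [IsProper r] {x : X'} (hx : r x ≠ closedPoint O)
    (T : Closeds X') (hT : (T : Set X') ⊆ r ⁻¹' {closedPoint O}) (z : ↥(vanishingIdeal T).subscheme)
    (hzc' : IsClosed ({((vanishingIdeal T).subschemeι z : X')} : Set X'))
    (hreg : IsRegularLocalRing (X'.presheaf.stalk ((vanishingIdeal T).subschemeι z)))
    (hadm : ∃ u ∈ stalkIdeal (vanishingIdeal T) ((vanishingIdeal T).subschemeι z),
      u ∉ maximalIdeal (X'.presheaf.stalk ((vanishingIdeal T).subschemeι z)) ^ 2) :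
    ∃ C : X'.IdealSheafData, Scheme.IsRegular C.subscheme ∧ Flat (C.subschemeι ≫ r) ∧
      (C.support : Set X') ∩ r ⁻¹' {closedPoint O} = {((vanishingIdeal T).subschemeι z : X')} ∧
      ∃ hzc : IsClosed ({z} : Set ↥(vanishingIdeal T).subscheme),
        C.comap (vanishingIdeal T).subschemeι = vanishingIdeal ⟨{z}, hzc⟩ := by
  -- `z` is closed in `V(T)` (closed embedding)
  have hzc : IsClosed ({z} : Set ↥(vanishingIdeal T).subscheme) := by
    convert hzc'.preimage (vanishingIdeal T).subschemeι.continuous using 1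
    refine Set.ext fun y => ⟨?_, fun hy => ?_⟩
    · rintro rfl; rfl
    · exact (vanishingIdeal T).subschemeι.isClosedEmbedding.injective hy
  have hb : r ((vanishingIdeal T).subschemeι z) = closedPoint O := hT (ComponentGluing.mem_of_subscheme_vanishingIdeal T z)
  have hinj := injective_stalkHom_of_isIntegral r (asIdeal_eq_bot_of_ne_closedPoint hx) ((vanishingIdeal T).subschemeι z)
  have hres := residue_comp_stalkHom_surjective r hzc' hb
  obtain ⟨C, hCreg, hCfl, hCsf, hCtr⟩ := exists_multisection r T hT z hzc hreg hinj hres hadm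
  exact ⟨C, hCreg, hCfl, hCsf, hzc, hCtr⟩

/-! ## The admissibility predicate «embedding dimension ≤ n» and its iso-invariance -/

/-- **`hAdm` for `Adm Γ x :⟺ μ(𝔪_{Γ,x}) ≤ n`.** An isomorphism of schemes induces isomorphisms of local rings, and the minimal
number of generators of the maximal ideal is invariant under ring isomorphisms — for ALL schemes, no Noetherian hypothesis.
[folklore] -/
theorem spanFinrank_maximalIdeal_stalk_le_of_iso (n : ℕ) (Γ Γ' : Scheme.{0}) (e : Γ ≅ Γ') (x : Γ)
    (h : (maximalIdeal (Γ.presheaf.stalk x)).spanFinrank ≤ n) :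
    (maximalIdeal (Γ'.presheaf.stalk (e.hom x))).spanFinrank ≤ n := by
  let f : Γ'.presheaf.stalk (e.hom x) ≃+* Γ.presheaf.stalk x := (asIso (e.hom.stalkMap x)).commRingCatIsoToRingEquiv
  rw [← map_ringEquiv_maximalIdeal f.symm, Ideal.spanFinrank_map_eq_of_ringEquiv]
  exact h

/-- From `μ(𝔪_{V(T),z}) ≤ n` and `dim 𝒪_{X',ι z} = n + 1` with `𝒪_{X',ι z}` regular: `(I_T)_{ι z} ⊄ 𝔪²` (the local ring of
`V(T)` at `z` is `𝒪_{X',ι z}/(I_T)_{ι z}`; res-type-097's `exists_mem_not_mem_sq_iff_spanFinrank_lt`). [cite: Matsumura1987, Thm. 14.2] -/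
theorem exists_not_mem_sq_of_spanFinrank_stalk_le {X' : Scheme.{0}} (J : X'.IdealSheafData) (z : ↥J.subscheme) {n : ℕ}
    (hreg : IsRegularLocalRing (X'.presheaf.stalk (J.subschemeι z)))
    (hdim : ringKrullDim (X'.presheaf.stalk (J.subschemeι z)) = (n + 1 : ℕ))
    (h : (maximalIdeal (J.subscheme.presheaf.stalk z)).spanFinrank ≤ n) :
    ∃ u ∈ stalkIdeal J (J.subschemeι z), u ∉ maximalIdeal (X'.presheaf.stalk (J.subschemeι z)) ^ 2 := by
  haveI := hreg
  obtain ⟨e⟩ := nonempty_stalkSubschemeEquiv J z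
  haveI : IsLocalRing (X'.presheaf.stalk (J.subschemeι z) ⧸ stalkIdeal J (J.subschemeι z)) := e.symm.isLocalRing
  rw [exists_mem_not_mem_sq_iff_spanFinrank_lt, spanFinrank_maximalIdeal_eq_of_ringKrullDim_eq hdim,
    ← Ideal.spanFinrank_map_eq_of_ringEquiv e, map_ringEquiv_maximalIdeal e]
  omega

/-- The same from res-D-pv-013's spelling `dim_κ 𝔪_{V(T),z}/𝔪² ≤ n` (res-type-097's
`exists_not_mem_sq_of_finrank_cotangentSpace_le_of_ringEquiv`). [cite: Matsumura1987, Thm. 14.2] -/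
theorem exists_not_mem_sq_of_finrank_cotangentSpace_stalk_le {X' : Scheme.{0}} (J : X'.IdealSheafData) (z : ↥J.subscheme)
    {n : ℕ} (hreg : IsRegularLocalRing (X'.presheaf.stalk (J.subschemeι z)))
    (hdim : ringKrullDim (X'.presheaf.stalk (J.subschemeι z)) = (n + 1 : ℕ))
    (h : Module.finrank (ResidueField (J.subscheme.presheaf.stalk z)) (CotangentSpace (J.subscheme.presheaf.stalk z)) ≤ n) :
    ∃ u ∈ stalkIdeal J (J.subschemeι z), u ∉ maximalIdeal (X'.presheaf.stalk (J.subschemeι z)) ^ 2 := by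
  haveI := hreg
  obtain ⟨e⟩ := nonempty_stalkSubschemeEquiv J z
  refine exists_not_mem_sq_of_finrank_cotangentSpace_le_of_ringEquiv _ e.symm h ?_
  rw [finrank_cotangentSpace_eq_of_ringKrullDim_eq hdim]

/-! ## The adapter -/

/-- **THE ADAPTER `hMS` := T-MULTISEC ⇒ T-TAIL (`Adm Γ x :⟺ μ(𝔪_{Γ,x}) ≤ n`).** In the setting of T-TAIL (`P` integral,
`q : P → Spec O` smooth, `Y ⊆ q⁻¹{s₀}` closed irreducible, `Ch`-stages are chains of blow-ups from `Y`) over a COMPLETE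
discrete valuation ring `O` with ALGEBRAICALLY CLOSED residue field, and given the dimension input `hdim` («`dim 𝒪_{X',x} = n + 1`
at every closed point `x` of the special fibre of every `Ch`-stage», T-DIM), the device (MS) holds: at every `Ch`-stage
`(X', σ', S')` (locally Noetherian, regular, proper over `O`), through every point `z` of `V(closure S')_red` closed in `X'` with
`μ(𝔪_{V(closure S'),z}) ≤ n` there is `C` with `V(C)` regular, flat over `O`, `supp C ∩ (σ' ≫ q)⁻¹{s₀} = {ι z}` and
`C · 𝒪_{V(closure S')} = 𝓘_{{z}}`. Proof: the stage is integral with a point over the generic point (res-D-pv-013), `closure S'`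
lies in the special fibre (`closure_subset_preimage_of_chain`), the embedding dimension drop gives `(I_T)_{ι z} ⊄ 𝔪²`
(res-type-097), and `exists_centre_of_stage` applies. The non-regularity hypothesis of the binder is not used.
[folklore packaging; cite: Matsumura1987, Thm. 8.4 and Thm. 14.2] -/
theorem hMS_of_multisection (O : Type) [CommRing O] [IsDomain O] [IsDiscreteValuationRing O]
    [IsAdicComplete (maximalIdeal O) O] [IsAlgClosed (ResidueField O)]
    (P : Scheme.{0}) [IsIntegral P] (q : P ⟶ Spec (.of O)) (Y : Closeds P)
    (Ch : ∀ X' : Scheme.{0}, (X' ⟶ P) → Set X' → Prop)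
    (hChain : ∀ (X' : Scheme.{0}) (σ : X' ⟶ P) (S : Set X'), Ch X' σ S → Chain P (Y : Set P) X' σ S)
    (hq : Smooth q) (hY : (Y : Set P) ⊆ q ⁻¹' {IsLocalRing.closedPoint O}) (hYirr : IsIrreducible (Y : Set P)) (n : ℕ)
    (hdim : ∀ (X' : Scheme.{0}) (σ' : X' ⟶ P) (S' : Set X'), Ch X' σ' S' → ∀ x : X', IsClosed ({x} : Set X') →
      (σ' ≫ q) x = IsLocalRing.closedPoint O → ringKrullDim (X'.presheaf.stalk x) = (n + 1 : ℕ)) :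
    ∀ (X' : Scheme.{0}) (σ' : X' ⟶ P) (S' : Set X'), Ch X' σ' S' → IsLocallyNoetherian X' →
      Scheme.IsRegular X' → IsProper (σ' ≫ q) →
      ∀ (z : ↥(vanishingIdeal (⟨closure S', isClosed_closure⟩ : Closeds X')).subscheme),
        IsClosed ({((vanishingIdeal (⟨closure S', isClosed_closure⟩ : Closeds X')).subschemeι z : X')} : Set X') →
        ¬ IsRegularLocalRing ((vanishingIdeal (⟨closure S', isClosed_closure⟩ : Closeds X')).subscheme.presheaf.stalk z) →
        (maximalIdeal ((vanishingIdeal (⟨closure S', isClosed_closure⟩ : Closeds X')).subscheme.presheaf.stalk z)).spanFinrank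
            ≤ n →
        ∃ C : X'.IdealSheafData, Scheme.IsRegular C.subscheme ∧ Flat (C.subschemeι ≫ σ' ≫ q) ∧
          (C.support : Set X') ∩ (σ' ≫ q) ⁻¹' {IsLocalRing.closedPoint O} =
            {((vanishingIdeal (⟨closure S', isClosed_closure⟩ : Closeds X')).subschemeι z : X')} ∧
          ∃ hzc : IsClosed ({z} : Set ↥(vanishingIdeal (⟨closure S', isClosed_closure⟩ : Closeds X')).subscheme),
            C.comap (vanishingIdeal (⟨closure S', isClosed_closure⟩ : Closeds X')).subschemeι = vanishingIdeal ⟨{z}, hzc⟩ := by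
  intro X' σ' S' hCh _ hXreg hprop z hzc' _ hadm
  haveI := hprop
  haveI := hq
  obtain ⟨ξ, hξ⟩ : ∃ ξ : P, IsGenericPoint ξ (Y : Set P) := QuasiSober.sober hYirr Y.isClosed
  have hch := hChain X' σ' S' hCh
  obtain ⟨hint, x, hx⟩ := chain_isIntegral_and_exists_over_genericPoint hξ hch
  haveI := hint
  -- the point `x` over the generic point of `P` is off the special fibre
  obtain ⟨y₀, -⟩ := hYirr.nonempty
  have hη : (q (genericPoint P)).asIdeal = ⊥ := asIdeal_apply_genericPoint_eq_bot q y₀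
  have hx' : (σ' ≫ q) x ≠ IsLocalRing.closedPoint O := by
    intro h
    have h' : (q (genericPoint P)).asIdeal = maximalIdeal O := by
      rw [← hx, ← Scheme.Hom.comp_apply, h]; rfl
    exact IsDiscreteValuationRing.not_a_field O (h'.symm.trans hη)
  -- the running surface lies in the special fibre
  have hT : ((⟨closure S', isClosed_closure⟩ : Closeds X') : Set X') ⊆ (σ' ≫ q) ⁻¹' {IsLocalRing.closedPoint O} :=
    closure_subset_preimage_of_chain q hYirr Y.isClosed hY hch
  have hb : (σ' ≫ q) ((vanishingIdeal (⟨closure S', isClosed_closure⟩ : Closeds X')).subschemeι z) = IsLocalRing.closedPoint O :=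
    hT (ComponentGluing.mem_of_subscheme_vanishingIdeal _ z)
  have hreg : IsRegularLocalRing (X'.presheaf.stalk ((vanishingIdeal (⟨closure S', isClosed_closure⟩ : Closeds X')).subschemeι z)) := hXreg _
  have hadm' := exists_not_mem_sq_of_spanFinrank_stalk_le (vanishingIdeal (⟨closure S', isClosed_closure⟩ : Closeds X')) z hreg
    (hdim X' σ' S' hCh _ hzc' hb) hadm
  exact exists_centre_of_stage (σ' ≫ q) hx' _ hT z hzc' hreg hadm'

/-- **THE ADAPTER, res-D-pv-013's spelling `Adm Γ x :⟺ dim_κ 𝔪_{Γ,x}/𝔪² ≤ n`.** Same statement and proof with the cotangent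
finrank in place of `μ` (equal on Noetherian local rings). [folklore packaging; cite: Matsumura1987, Thm. 8.4 and Thm. 14.2] -/
theorem hMS_of_multisection_finrank (O : Type) [CommRing O] [IsDomain O] [IsDiscreteValuationRing O]
    [IsAdicComplete (maximalIdeal O) O] [IsAlgClosed (ResidueField O)]
    (P : Scheme.{0}) [IsIntegral P] (q : P ⟶ Spec (.of O)) (Y : Closeds P)
    (Ch : ∀ X' : Scheme.{0}, (X' ⟶ P) → Set X' → Prop)
    (hChain : ∀ (X' : Scheme.{0}) (σ : X' ⟶ P) (S : Set X'), Ch X' σ S → Chain P (Y : Set P) X' σ S)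
    (hq : Smooth q) (hY : (Y : Set P) ⊆ q ⁻¹' {IsLocalRing.closedPoint O}) (hYirr : IsIrreducible (Y : Set P)) (n : ℕ)
    (hdim : ∀ (X' : Scheme.{0}) (σ' : X' ⟶ P) (S' : Set X'), Ch X' σ' S' → ∀ x : X', IsClosed ({x} : Set X') →
      (σ' ≫ q) x = IsLocalRing.closedPoint O → ringKrullDim (X'.presheaf.stalk x) = (n + 1 : ℕ)) :
    ∀ (X' : Scheme.{0}) (σ' : X' ⟶ P) (S' : Set X'), Ch X' σ' S' → IsLocallyNoetherian X' →
      Scheme.IsRegular X' → IsProper (σ' ≫ q) →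
      ∀ (z : ↥(vanishingIdeal (⟨closure S', isClosed_closure⟩ : Closeds X')).subscheme),
        IsClosed ({((vanishingIdeal (⟨closure S', isClosed_closure⟩ : Closeds X')).subschemeι z : X')} : Set X') →
        ¬ IsRegularLocalRing ((vanishingIdeal (⟨closure S', isClosed_closure⟩ : Closeds X')).subscheme.presheaf.stalk z) →
        Module.finrank (ResidueField ((vanishingIdeal (⟨closure S', isClosed_closure⟩ : Closeds X')).subscheme.presheaf.stalk z))
            (CotangentSpace ((vanishingIdeal (⟨closure S', isClosed_closure⟩ : Closeds X')).subscheme.presheaf.stalk z)) ≤ n →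
        ∃ C : X'.IdealSheafData, Scheme.IsRegular C.subscheme ∧ Flat (C.subschemeι ≫ σ' ≫ q) ∧
          (C.support : Set X') ∩ (σ' ≫ q) ⁻¹' {IsLocalRing.closedPoint O} =
            {((vanishingIdeal (⟨closure S', isClosed_closure⟩ : Closeds X')).subschemeι z : X')} ∧
          ∃ hzc : IsClosed ({z} : Set ↥(vanishingIdeal (⟨closure S', isClosed_closure⟩ : Closeds X')).subscheme),
            C.comap (vanishingIdeal (⟨closure S', isClosed_closure⟩ : Closeds X')).subschemeι = vanishingIdeal ⟨{z}, hzc⟩ := by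
  intro X' σ' S' hCh _ hXreg hprop z hzc' _ hadm
  haveI := hprop
  haveI := hq
  obtain ⟨ξ, hξ⟩ : ∃ ξ : P, IsGenericPoint ξ (Y : Set P) := QuasiSober.sober hYirr Y.isClosed
  have hch := hChain X' σ' S' hCh
  obtain ⟨hint, x, hx⟩ := chain_isIntegral_and_exists_over_genericPoint hξ hch
  haveI := hint
  obtain ⟨y₀, -⟩ := hYirr.nonempty
  have hη : (q (genericPoint P)).asIdeal = ⊥ := asIdeal_apply_genericPoint_eq_bot q y₀
  have hx' : (σ' ≫ q) x ≠ IsLocalRing.closedPoint O := by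
    intro h
    have h' : (q (genericPoint P)).asIdeal = maximalIdeal O := by
      rw [← hx, ← Scheme.Hom.comp_apply, h]; rfl
    exact IsDiscreteValuationRing.not_a_field O (h'.symm.trans hη)
  have hT : ((⟨closure S', isClosed_closure⟩ : Closeds X') : Set X') ⊆ (σ' ≫ q) ⁻¹' {IsLocalRing.closedPoint O} :=
    closure_subset_preimage_of_chain q hYirr Y.isClosed hY hch
  have hb : (σ' ≫ q) ((vanishingIdeal (⟨closure S', isClosed_closure⟩ : Closeds X')).subschemeι z) = IsLocalRing.closedPoint O :=
    hT (ComponentGluing.mem_of_subscheme_vanishingIdeal _ z)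
  have hreg : IsRegularLocalRing (X'.presheaf.stalk ((vanishingIdeal (⟨closure S', isClosed_closure⟩ : Closeds X')).subschemeι z)) := hXreg _
  have hadm' := exists_not_mem_sq_of_finrank_cotangentSpace_stalk_le (vanishingIdeal (⟨closure S', isClosed_closure⟩ : Closeds X')) z hreg
    (hdim X' σ' S' hCh _ hzc' hb) hadm
  exact exists_centre_of_stage (σ' ≫ q) hx' _ hT z hzc' hreg hadm'

end Summit.ResolutionOfSingularities.ResolutionOfSingularities.Cruxes.EquisingularLiftNat.Sections
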